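import Mathlib.LinearAlgebra.Dual.Lemmas
import Mathlib.Algebra.Algebra.Subalgebra.Centralizer
import Mathlib.Algebra.Algebra.Subalgebra.Lattice
import Mathlib.RingTheory.Adjoin.Basic
import Mathlib.LinearAlgebra.FiniteDimensional.Lemmas
import HarnessLib

/-!
# Transport of the dimension identity `dim Z(S) · dim S = (dim V)²` under transposition `S ↦ Sᵀ ⊆ End(V^∨)`

Topic `Literature/LinearAlgebra/BaseChange` (namespace `Literature.LinearAlgebra.BaseChange`), companion of ★
`DimensionIdentityTransport` (base changes, conjugation, blocks).  THEOREMS ONLY (pure Mathlib; no definition, no named fact, no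
instance, no `sorry`).

PRINTED RESULTS.  N. Bourbaki, *Algebra I, Chapters 1–3* (Springer 1989), Ch. II §2 no. 5 (the transpose of a linear mapping,
Definition 5 and formulae (16)–(18): `ᵗ(u₁ + u₂) = ᵗu₁ + ᵗu₂`, `ᵗ(v ∘ u) = ᵗu ∘ ᵗv`, `ᵗ1 = 1`, p0334), Ch. II §2 no. 7 (bidual: Proposition 13 and
Corollary 3 — for modules with finite bases `ᵗᵗu = u`, so `u ↦ ᵗu` is injective, p0338) and Ch. II §7 no. 5 (dual of a vector space: `dim E* = dim E`
for `E` finite-dimensional, Theorem 4, p0398).  Consequently, for a finite-dimensional `V`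
and a subalgebra `S ⊆ End_k V`, the transposed algebra `Sᵀ := {ᵗs} ⊆ End_k V^∨` is anti-isomorphic to `S` (same dimension, centre carried
to centre), and the identity `dim_k Z(S) · dim_k S = (dim_k V)²` holds for `(V, S)` iff it holds for `(V^∨, Sᵀ)`.

THIS FILE (variance bridge for consumers whose rational module is COVARIANT, `H₁`, while the `ℓ`-adic block is CONTRAVARIANT, `H¹_ét`):
* §1 `dualMap_injective_of_finite` (`u ↦ ᵗu` is injective on `End_k V`, `V` finite-dimensional); `dualMap_mem_adjoin_transpose`,
  `mem_adjoin_transpose_iff` (the subalgebra generated by a transposed family `ᵗ(a i)` is EXACTLY `{ᵗf | f ∈ k⟨a⟩}` — transposition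
  is an anti-homomorphism); `finrank_adjoin_transpose_eq`, `finrank_center_adjoin_transpose_eq`.
* §2 **`finrank_center_mul_finrank_adjoin_transpose_iff`**: for any family `a : I → End_k V`,
  `dim Z(k⟨ᵗa⟩) · dim k⟨ᵗa⟩ = (dim V^∨)² ↔ dim Z(k⟨a⟩) · dim k⟨a⟩ = (dim V)²`, centres taken as `S ⊓ C(S)`.

DICTIONARY LINE (cell `hodgecm-mathlib`, crux `HLiu418` = stmt-HodgeConjecture-24832, d6 S2′ degree road (D3)): `k := ℚ`, `V :=` the covariant
`ε`-block of the rational representation (`SocketBetti` v2, A-p04/A-p11), `V^∨ :=` its `H¹`-variance twin, on which the Betti–étale comparison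
to `ℚ̄_ℓ ⊗ (V_ℓ A_K)^∨` lands.  Moves no book (HC_CM is proved only modulo the 7 printed citations until rung 0 closes).

## References
* [BourbakiAlgebraI1989] N. Bourbaki, *Algebra I, Chapters 1–3*, Springer (1989): Ch. II §2 no. 5 Def. 5, formulae (16)–(18) (p0334); Ch. II
  §2 no. 7 Prop. 13 and Cor. 3 (p0338); Ch. II §7 no. 5 Thm. 4 (p0398); Ch. III §4 no. 4 Corollary (p0569) (centres).
* [Lang2002] S. Lang, *Algebra*, 3rd ed. (2002), XIII §1–§2 (matrices, transpose), XVII §1.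
-/

set_option autoImplicit false

open Module

namespace Literature.LinearAlgebra.BaseChange

section Transpose

variable {k : Type*} [Field k] {V : Type*} [AddCommGroup V] [Module k V]

/-- `ᵗ(f g) = ᵗg ᵗf` in `End`. [cite: BourbakiAlgebraI1989, Ch. II §2 no. 5 formula (17) (p0334)] -/
theorem dualMap_mul (f g : Module.End k V) : (f * g).dualMap = g.dualMap * f.dualMap := by
  rw [Module.End.mul_eq_comp, Module.End.mul_eq_comp, LinearMap.dualMap_comp_dualMap]

/-- `ᵗ(c · 1) = c · 1`. [cite: BourbakiAlgebraI1989, Ch. II §2 no. 5 formulae (16), (18) (p0334)] -/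
theorem dualMap_algebraMap (c : k) :
    (algebraMap k (Module.End k V) c).dualMap = algebraMap k (Module.End k (Module.Dual k V)) c := by
  rw [Algebra.algebraMap_eq_smul_one, Algebra.algebraMap_eq_smul_one, LinearMap.dualMap_def, map_smul,
    ← LinearMap.dualMap_def, Module.End.one_eq_id, LinearMap.dualMap_id, Module.End.one_eq_id]

/-- `ᵗ(f + g) = ᵗf + ᵗg`. [cite: BourbakiAlgebraI1989, Ch. II §2 no. 5 formula (16) (p0334)] -/
theorem dualMap_add (f g : Module.End k V) : (f + g).dualMap = f.dualMap + g.dualMap := by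
  rw [LinearMap.dualMap_def, map_add, ← LinearMap.dualMap_def, ← LinearMap.dualMap_def]

/-- **`u ↦ ᵗu` is injective on `End_k V` for `V` finite-dimensional** (a vector killed by every linear form is zero).
[cite: BourbakiAlgebraI1989, Ch. II §2 no. 7 Proposition 13 and Corollary 3 (p0338)] -/
theorem dualMap_injective_of_finite [FiniteDimensional k V] :
    Function.Injective fun f : Module.End k V => f.dualMap := by
  intro f g hfg
  refine LinearMap.ext fun v => sub_eq_zero.1 ((Module.forall_dual_apply_eq_zero_iff k (f v - g v)).1 fun φ => ?_)
  have h := LinearMap.congr_fun (LinearMap.congr_fun hfg φ) v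
  simp only [LinearMap.dualMap_apply] at h
  rw [map_sub, h, sub_self]

/-- The transpose of an element of `k⟨a⟩` lies in `k⟨ᵗa⟩`. [cite: BourbakiAlgebraI1989, Ch. II §2 no. 5 formulae (16)–(18) (p0334)] -/
theorem dualMap_mem_adjoin_transpose {I : Type*} (a : I → Module.End k V) {f : Module.End k V}
    (hf : f ∈ Algebra.adjoin k (Set.range a)) :
    f.dualMap ∈ Algebra.adjoin k (Set.range fun i => (a i).dualMap) := by
  induction hf using Algebra.adjoin_induction with
  | mem x hx =>
    obtain ⟨i, rfl⟩ := hx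
    exact Algebra.subset_adjoin ⟨i, rfl⟩
  | algebraMap c =>
    rw [dualMap_algebraMap]
    exact Subalgebra.algebraMap_mem _ c
  | add x y _ _ hx hy =>
    rw [dualMap_add]
    exact Subalgebra.add_mem _ hx hy
  | mul x y _ _ hx hy =>
    rw [dualMap_mul]
    exact Subalgebra.mul_mem _ hy hx

/-- **`k⟨ᵗa⟩ = {ᵗf | f ∈ k⟨a⟩}`**: the subalgebra generated by a transposed family is the transpose of the generated subalgebra
(transposition is an anti-homomorphism, so the image of a subalgebra is a subalgebra). [cite: BourbakiAlgebraI1989, Ch. II §2 no. 5 formulae (16)–(18) (p0334)] -/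
theorem mem_adjoin_transpose_iff {I : Type*} (a : I → Module.End k V) (g : Module.End k (Module.Dual k V)) :
    g ∈ Algebra.adjoin k (Set.range fun i => (a i).dualMap) ↔ ∃ f ∈ Algebra.adjoin k (Set.range a), f.dualMap = g := by
  constructor
  · intro hg
    induction hg using Algebra.adjoin_induction with
    | mem x hx =>
      obtain ⟨i, rfl⟩ := hx
      exact ⟨a i, Algebra.subset_adjoin ⟨i, rfl⟩, rfl⟩
    | algebraMap c => exact ⟨algebraMap k _ c, Subalgebra.algebraMap_mem _ c, dualMap_algebraMap c⟩
    | add x y _ _ hx hy =>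
      obtain ⟨f, hf, rfl⟩ := hx
      obtain ⟨f', hf', rfl⟩ := hy
      exact ⟨f + f', Subalgebra.add_mem _ hf hf', dualMap_add f f'⟩
    | mul x y _ _ hx hy =>
      obtain ⟨f, hf, rfl⟩ := hx
      obtain ⟨f', hf', rfl⟩ := hy
      exact ⟨f' * f, Subalgebra.mul_mem _ hf' hf, dualMap_mul f' f⟩
  · rintro ⟨f, hf, rfl⟩
    exact dualMap_mem_adjoin_transpose a hf

/-- As submodules: `k⟨ᵗa⟩ = ᵗ(k⟨a⟩)` (image under the linear map `u ↦ ᵗu`, Mathlib `Module.Dual.transpose`).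
[cite: BourbakiAlgebraI1989, Ch. II §2 no. 5 Definition 5 and formulae (16)–(18) (p0334)] -/
theorem toSubmodule_adjoin_transpose_eq_map {I : Type*} (a : I → Module.End k V) :
    Subalgebra.toSubmodule (Algebra.adjoin k (Set.range fun i => (a i).dualMap)) =
      (Subalgebra.toSubmodule (Algebra.adjoin k (Set.range a))).map (Module.Dual.transpose (R := k)) := by
  ext g
  rw [Subalgebra.mem_toSubmodule, mem_adjoin_transpose_iff, Submodule.mem_map]
  simp only [Subalgebra.mem_toSubmodule, ← LinearMap.dualMap_def]

/-- The centre is carried to the centre: `k⟨ᵗa⟩ ⊓ C(k⟨ᵗa⟩) = ᵗ(k⟨a⟩ ⊓ C(k⟨a⟩))` (injectivity of `u ↦ ᵗu` for `⊆`).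
[cite: BourbakiAlgebraI1989, Ch. II §2 no. 7 Proposition 13 and Corollary 3 (p0338); Ch. III §4 no. 4 Corollary (p0569)] -/
theorem toSubmodule_center_adjoin_transpose_eq_map [FiniteDimensional k V] {I : Type*} (a : I → Module.End k V) :
    Subalgebra.toSubmodule (Algebra.adjoin k (Set.range fun i => (a i).dualMap) ⊓
        Subalgebra.centralizer k (Algebra.adjoin k (Set.range fun i => (a i).dualMap) : Set (Module.End k (Module.Dual k V)))) =
      (Subalgebra.toSubmodule (Algebra.adjoin k (Set.range a) ⊓
        Subalgebra.centralizer k (Algebra.adjoin k (Set.range a) : Set (Module.End k V)))).map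
          (Module.Dual.transpose (R := k)) := by
  ext g
  rw [Subalgebra.mem_toSubmodule, Algebra.mem_inf, Submodule.mem_map]
  constructor
  · rintro ⟨hg, hgc⟩
    obtain ⟨f, hf, rfl⟩ := (mem_adjoin_transpose_iff a g).1 hg
    refine ⟨f, ?_, (LinearMap.dualMap_def f).symm⟩
    rw [Subalgebra.mem_toSubmodule, Algebra.mem_inf]
    refine ⟨hf, (Subalgebra.mem_centralizer_iff k).2 fun s hs => dualMap_injective_of_finite ?_⟩
    change (s * f).dualMap = (f * s).dualMap
    rw [dualMap_mul, dualMap_mul]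
    exact ((Subalgebra.mem_centralizer_iff k).1 hgc _ (dualMap_mem_adjoin_transpose a hs)).symm
  · rintro ⟨f, hf, rfl⟩
    rw [Subalgebra.mem_toSubmodule, Algebra.mem_inf] at hf
    rw [← LinearMap.dualMap_def]
    refine ⟨dualMap_mem_adjoin_transpose a hf.1, (Subalgebra.mem_centralizer_iff k).2 fun g' hg' => ?_⟩
    obtain ⟨f', hf', rfl⟩ := (mem_adjoin_transpose_iff a g').1 hg'
    rw [← dualMap_mul, ← dualMap_mul, (Subalgebra.mem_centralizer_iff k).1 hf.2 f' hf']

/-- **`dim k⟨ᵗa⟩ = dim k⟨a⟩`.** [cite: BourbakiAlgebraI1989, Ch. II §2 no. 7 Proposition 13 and Corollary 3 (p0338)] -/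
theorem finrank_adjoin_transpose_eq [FiniteDimensional k V] {I : Type*} (a : I → Module.End k V) :
    finrank k ↥(Algebra.adjoin k (Set.range fun i => (a i).dualMap)) = finrank k ↥(Algebra.adjoin k (Set.range a)) := by
  have hτ : Function.Injective (Module.Dual.transpose (R := k) (M := V) (M' := V)) := fun f g h =>
    dualMap_injective_of_finite (by simpa only [LinearMap.dualMap_def] using h)
  rw [← Subalgebra.finrank_toSubmodule, ← Subalgebra.finrank_toSubmodule, toSubmodule_adjoin_transpose_eq_map,
    LinearEquiv.finrank_eq (Submodule.equivMapOfInjective _ hτ _).symm]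

/-- **`dim Z(k⟨ᵗa⟩) = dim Z(k⟨a⟩)`.** [cite: BourbakiAlgebraI1989, Ch. II §2 no. 7 Proposition 13 and Corollary 3 (p0338); Ch. III §4 no. 4 Corollary (p0569)] -/
theorem finrank_center_adjoin_transpose_eq [FiniteDimensional k V] {I : Type*} (a : I → Module.End k V) :
    finrank k ↥(Algebra.adjoin k (Set.range fun i => (a i).dualMap) ⊓
        Subalgebra.centralizer k (Algebra.adjoin k (Set.range fun i => (a i).dualMap) : Set (Module.End k (Module.Dual k V)))) =
      finrank k ↥(Algebra.adjoin k (Set.range a) ⊓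
        Subalgebra.centralizer k (Algebra.adjoin k (Set.range a) : Set (Module.End k V))) := by
  have hτ : Function.Injective (Module.Dual.transpose (R := k) (M := V) (M' := V)) := fun f g h =>
    dualMap_injective_of_finite (by simpa only [LinearMap.dualMap_def] using h)
  rw [← Subalgebra.finrank_toSubmodule, ← Subalgebra.finrank_toSubmodule, toSubmodule_center_adjoin_transpose_eq_map,
    LinearEquiv.finrank_eq (Submodule.equivMapOfInjective _ hτ _).symm]

/-- **(G2) the dimension identity is invariant under transposition**: for any family `a : I → End_k V` (`V` finite-dimensional),
`dim Z(k⟨ᵗa⟩)·dim k⟨ᵗa⟩ = (dim V^∨)² ↔ dim Z(k⟨a⟩)·dim k⟨a⟩ = (dim V)²`.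
[cite: BourbakiAlgebraI1989, Ch. II §2 no. 7 Proposition 13 and Corollary 3 (p0338) and Ch. II §7 no. 5 Theorem 4 (p0398)] -/
theorem finrank_center_mul_finrank_adjoin_transpose_iff [FiniteDimensional k V] {I : Type*} (a : I → Module.End k V) :
    finrank k ↥(Algebra.adjoin k (Set.range fun i => (a i).dualMap) ⊓
          Subalgebra.centralizer k
            (Algebra.adjoin k (Set.range fun i => (a i).dualMap) : Set (Module.End k (Module.Dual k V)))) *
        finrank k ↥(Algebra.adjoin k (Set.range fun i => (a i).dualMap)) = finrank k (Module.Dual k V) ^ 2 ↔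
      finrank k ↥(Algebra.adjoin k (Set.range a) ⊓
          Subalgebra.centralizer k (Algebra.adjoin k (Set.range a) : Set (Module.End k V))) *
        finrank k ↥(Algebra.adjoin k (Set.range a)) = finrank k V ^ 2 := by
  rw [finrank_center_adjoin_transpose_eq, finrank_adjoin_transpose_eq, Subspace.dual_finrank_eq]

end Transpose

end Literature.LinearAlgebra.BaseChange
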